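import Summits.CriticalPhenomena.Ising3DConformalLimit.Theorems.InverseSquareTelemetryTwoPointSpineComplementScreening
import Summits.CriticalPhenomena.Ising3DConformalLimit.Theorems.PrimaryAtInfinityTwoPointPowerLawEta
import Summits.CriticalPhenomena.Ising3DConformalLimit.Theorems.CanonicalBranchRefutationInfraredExponentZeroSphereMass
import Literature.Probability.LatticeModels.PointwiseScalingLimitEtaExists
import HarnessLib

/-!
# Crux `AnomalousForcesInteraction.EtaPositive` (stmt-CriticalPhenomena-2600) is NECESSARY for the
# sub-problem, and — given one scaling limit — EQUIVALENT to the `Δ > 1/2` items of the sibling routes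

THEOREM-ONLY support file for the crux `EtaPositive` (`η(3) > 0` in power-upper-bound form:
`∃ κ > 0, C, ∀ x ≠ 0, ⟨σ₀σ_x⟩⁺_{β_c(3)} ≤ C‖x‖^{-(1+κ)}`; item stmt-CriticalPhenomena-2600, crux of route
`AnomalousForcesInteraction`, target of route `OctaveForgetting`). No definition, no named fact, no `sorry`.

The crux is an open problem in print (Duminil-Copin, ICM 2022, §4.2/§8.4) and its only registered line
(`Cruxes/EtaPositive/Lines/registered.lean`, the critical-isotherm detour) is dead at `stub_isothermGain`.
This file records, BY NAME on the crux item, where the crux sits in the tree as of 2026-08-17 — facts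
proved today on OTHER routes (`InverseSquareTelemetry` crux 4497, `PrimaryAtInfinity` crux 5354,
`CanonicalBranchRefutation` crux 15521) and therefore invisible from the crux's own `served_by` record:

* `EtaPositive_of_ising3DConformalLimit` — **the crux is NECESSARY**: the sub-problem statement
  `Ising3DConformalLimit` (one non-degenerate, Möbius-covariant, non-Gaussian pointwise scaling limit of the
  critical Ising₃ correlators) implies `EtaPositive`; every route that reaches the summit conjunct proves
  the crux on the way (`etaPositive_of_critIsing3DConformalLimit`, route InverseSquareTelemetry).
* `EtaPositive_of_limit_of_half_lt_delta` / `EtaPositive_of_scaleCovariantLimit_gt_half` — ONE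
  non-degenerate pointwise limit that is scale covariant with SOME `Δ > 1/2` gives the crux (no rotations,
  no inversion, no `U₄`): the logarithmic exponent `η = 2Δ' - 1` of ANY non-degenerate limit exists
  (`HasPointwiseScalingLimit.exists_rpow_scale_mem_Icc_threeQuarters`), the covariance exponent of a
  non-degenerate family is unique (`Δ' = Δ`), and a positive logarithmic `η` is the crux with `κ = η/2`
  (`etaPositive_of_hasIsingExponentEta`).
* `EtaPositive_of_moebiusLimit_of_nonGaussian` — **1344 ∧ 0636 ⟹ 2600** inside route
  AnomalousForcesInteraction: its own rank-4 crux `MoebiusLimit` (stmt-1344) and the shared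
  non-Gaussianity crux `IsingEuclidUpgradeR4NonGaussian` (stmt-0636) pay the rank-2 crux
  (`etaPositive_of_limit_of_hasNontrivialU4`: edge Gaussianity at `Δ = 1/2`, proved on route
  GaussianScaleMixture / HyperoctahedralRP); `EtaPositive_of_limitExists_of_nonGaussian` is the same with
  bare existence `WeylWindow.LimitExists` (stmt-4738).
* **Equivalences given ONE non-degenerate limit** (`WeylWindow.LimitExists`, stmt-4738; in particular under
  this route's `MoebiusLimit`, `limitExists_of_moebiusLimit`):
  `EtaPositive ↔ PrimaryAtInfinity.TwoPointPowerLawEta` (stmt-5354; `EtaPositive_iff_twoPointPowerLawEta_of_limitExists`),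
  `EtaPositive ↔ ¬ CanonicalBranchRefutation.InfraredExponentZero` (stmt-15521, the `η_log(3) = 0` bet;
  `EtaPositive_iff_not_infraredExponentZero_of_limitExists`),
  `EtaPositive ↔ (every non-degenerate limit has scaling dimension > 1/2)`
  (`EtaPositive_iff_half_lt_delta_of_limitExists`).
* `EtaPositive_or_canonical` — **the unconditional dichotomy**: either the crux holds, or EVERY
  non-degenerate pointwise scaling limit of `criticalCorr 3` is canonical — normalised scaling dimension
  exactly `1/2`, logarithmic `η(3) = 0`, and `U₄ ≡ 0` on non-coincident quadruples. A refutation of the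
  crux must therefore live on the canonical (Gaussian-at-order-four) branch; a proof needs either a
  lattice exponent gain (isotherm/one-arm/thermal certificates of this namespace, all open) or ONE
  interacting limit.

Ledger reading (planner): the crux 2600 costs no truth-risk beyond the summit conjunct itself; its
single-item producers are stmt-8103 (`EtaPositive_of_sphereForgetting`, this namespace) and any route
assembly; its two-item producers are {4738 or 1344 or 1981} ∧ {0636 or 5354 or ¬15521}.

References: H. Duminil-Copin, Proc. ICM 2022, §4.2.1, §8.1, §8.4 [DuminilCopinICM2022];
H. Duminil-Copin, R. Panis, CMP 406 (2025), Thm 1.5 [DuminilCopinPanis2025LowerBounds];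
K. Pohlmeyer, CMP 12 (1969) (canonical dimension forces a generalised free field) [Pohlmeyer1969].
-/

noncomputable section

namespace Summit.CriticalPhenomena.Ising3DConformalLimit.AnomalousForcesInteractionEtaPositive

open Filter Topology
open Literature.Probability.LatticeModels
open Summit.CriticalPhenomena.Ising3DConformalLimit.Theses
open Summit.CriticalPhenomena.Ising3DConformalLimit.InverseSquareTelemetryTwoPointSpineComplement.Screening
  (etaPositive_of_hasIsingExponentEta etaPositive_of_limit_of_hasNontrivialU4
    etaPositive_of_critIsing3DConformalLimit)
open Summit.CriticalPhenomena.Ising3DConformalLimit.Theorems.PrimaryAtInfinityTwoPointPowerLawEta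
  (twoPoint_structure_of_limit twoPointPowerLawEta_of_etaPositive etaPos_of_twoPointPowerLawEta
    twoPointPowerLawEta_iff_half_lt_delta)
open Summit.CriticalPhenomena.Ising3DConformalLimit.Theorems (not_infraredExponentZero_of_etaPositive)

/-! ### Necessity: the sub-problem statement gives the crux -/

/-- **The crux is necessary for the summit conjunct.** `Ising3DConformalLimit` (a non-degenerate,
Möbius-covariant pointwise scaling limit of the critical Ising₃ correlators with `U₄ ≢ 0`) implies
`EtaPositive`: the interacting limit has scaling dimension `Δ > 1/2` (edge Gaussianity at `Δ = 1/2`), the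
logarithmic exponent `η = 2Δ - 1 > 0` of `⟨σ₀σ_x⟩_{β_c(3)}` exists, and a positive logarithmic `η` gives the
power upper bound with `κ = η/2`. (Registered sub-goal of the crux item; header verbatim on one line.)
[cite: DuminilCopinICM2022, §8.1 and §8.4] -/
theorem EtaPositive_of_ising3DConformalLimit : Ising3DConformalLimit → Summit.CriticalPhenomena.Ising3DConformalLimit.Theses.AnomalousForcesInteraction.EtaPositive :=
  fun h => etaPositive_of_critIsing3DConformalLimit h

/-! ### One scale-covariant limit with `Δ > 1/2` gives the crux -/

/-- **One non-degenerate pointwise limit, scale covariant with some `Δ > 1/2`, gives the crux** (no rotation,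
inversion or four-point input). Any non-degenerate pointwise limit of `criticalCorr 3` carries a dimension
`Δ'` with covariance on non-coincident configurations and the logarithmic exponent `η = 2Δ' - 1`
(`HasPointwiseScalingLimit.exists_rpow_scale_mem_Icc_threeQuarters`); reading both covariance laws at the
reference pair `(0, e₀)` and scale `2` gives `Δ' = Δ`, so `η > 0`, whence `EtaPositive`
(`etaPositive_of_hasIsingExponentEta`). [cite: DuminilCopinPanis2025LowerBounds, Theorem 1.5] -/
theorem EtaPositive_of_limit_of_half_lt_delta {ρ : ℝ → ℝ} {S : CorrFamily 3} {Δ : ℝ}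
    (hρ : ∀ δ ∈ Set.Ioc (0:ℝ) 1, 0 < ρ δ) (hlim : HasPointwiseScalingLimit (criticalCorr 3) ρ S)
    (hnd : IsNondegenerateTwoPoint S) (hsc : IsScaleCovariant Δ S) (hΔ : 1 / 2 < Δ) :
    AnomalousForcesInteraction.EtaPositive := by
  obtain ⟨Δ', -, hcov, -, hη⟩ := hlim.exists_rpow_scale_mem_Icc_threeQuarters hρ hnd
  -- the two covariance exponents coincide: read them at the reference pair, scale `2`
  have hx₀ := refPair_mem_nonCoincident (d := 3) (by norm_num)
  set x₀ : Fin 2 → EuclideanSpace ℝ (Fin 3) :=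
    ![0, EuclideanSpace.single (⟨0, by norm_num⟩ : Fin 3) (1:ℝ)] with hx₀def
  have ha : 0 < S 2 x₀ := hnd _ hx₀
  have heq : Δ' = Δ := by
    have e₁ := hcov 2 2 two_pos x₀ hx₀
    have e₂ := hsc 2 2 two_pos x₀
    rw [e₁] at e₂
    have h := mul_right_cancel₀ ha.ne' e₂
    have hl : 0 < Real.log 2 := Real.log_pos one_lt_two
    have h' := congrArg Real.log h
    rw [Real.log_rpow two_pos, Real.log_rpow two_pos] at h'
    have h'' := mul_right_cancel₀ hl.ne' h'
    push_cast at h''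
    linarith
  subst heq
  exact etaPositive_of_hasIsingExponentEta (by linarith) hη

/-- **By name**: a non-degenerate pointwise scaling limit of the critical Ising₃ correlators that is scale
covariant with a dimension `Δ > 1/2` gives `EtaPositive`. [cite: DuminilCopinPanis2025LowerBounds, Theorem 1.5] -/
theorem EtaPositive_of_scaleCovariantLimit_gt_half :
    (∃ (ρ : ℝ → ℝ) (Δ : ℝ) (S : CorrFamily 3), (∀ δ ∈ Set.Ioc (0:ℝ) 1, 0 < ρ δ) ∧ 1 / 2 < Δ ∧
        HasPointwiseScalingLimit (criticalCorr 3) ρ S ∧ IsNondegenerateTwoPoint S ∧ IsScaleCovariant Δ S) →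
      AnomalousForcesInteraction.EtaPositive := by
  rintro ⟨ρ, Δ, S, hρ, hΔ, hlim, hnd, hsc⟩
  exact EtaPositive_of_limit_of_half_lt_delta hρ hlim hnd hsc hΔ

/-! ### Item-level producers: existence ∧ non-Gaussianity pay the crux -/

/-- **This route's crux `MoebiusLimit` (stmt-1344) supplies a non-degenerate limit** (`WeylWindow.LimitExists`,
stmt-4738). [folklore] -/
theorem limitExists_of_moebiusLimit (h : AnomalousForcesInteraction.MoebiusLimit) : WeylWindow.LimitExists := by
  obtain ⟨ρ, -, S, hρ, -, hlim, hnd, -⟩ := h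
  exact ⟨ρ, S, hρ, hlim, hnd⟩

/-- **4738 ∧ 0636 ⟹ 2600, by name**: bare existence of a non-degenerate pointwise limit
(`WeylWindow.LimitExists`, stmt-4738) and non-Gaussianity of every such limit
(`IsingEuclidUpgrade.IsingEuclidUpgradeR4NonGaussian`, stmt-0636) give `EtaPositive`. [folklore] -/
theorem EtaPositive_of_limitExists_of_nonGaussian (hL : WeylWindow.LimitExists)
    (hN : IsingEuclidUpgrade.IsingEuclidUpgradeR4NonGaussian) : AnomalousForcesInteraction.EtaPositive := by
  obtain ⟨ρ, S, hρ, hlim, hnd⟩ := hL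
  exact etaPositive_of_limit_of_hasNontrivialU4 hρ hlim hnd (hN ρ S hρ hlim hnd)

/-- **1344 ∧ 0636 ⟹ 2600 inside route AnomalousForcesInteraction**: its rank-4 crux `MoebiusLimit` and the
shared non-Gaussianity crux 0636 pay its rank-2 crux `EtaPositive`. (Registered sub-goal of the crux item;
header verbatim on one line.) [folklore] -/
theorem EtaPositive_of_moebiusLimit_of_nonGaussian : Summit.CriticalPhenomena.Ising3DConformalLimit.Theses.AnomalousForcesInteraction.MoebiusLimit → Summit.CriticalPhenomena.Ising3DConformalLimit.Theses.IsingEuclidUpgrade.IsingEuclidUpgradeR4NonGaussian → Summit.CriticalPhenomena.Ising3DConformalLimit.Theses.AnomalousForcesInteraction.EtaPositive :=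
  fun hM hN => EtaPositive_of_limitExists_of_nonGaussian (limitExists_of_moebiusLimit hM) hN

/-! ### Equivalences given one non-degenerate limit -/

/-- **Under stmt-4738, the crux 2600 ⟺ the crux 5354** (`PrimaryAtInfinity.TwoPointPowerLawEta`: every
non-degenerate limit has the isotropic pure power two-point law with `Δ > 1/2`). `→` is unconditional
(`twoPointPowerLawEta_of_etaPositive`, through the landed `DeltaLowerBound_proof`); `←` reads the logarithmic
exponent `η = 2Δ - 1` of the given limit (`twoPoint_structure_of_limit`), positive by
`etaPos_of_twoPointPowerLawEta`. [folklore] -/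
theorem EtaPositive_iff_twoPointPowerLawEta_of_limitExists (hL : WeylWindow.LimitExists) :
    AnomalousForcesInteraction.EtaPositive ↔ PrimaryAtInfinity.TwoPointPowerLawEta := by
  refine ⟨twoPointPowerLawEta_of_etaPositive, fun h => ?_⟩
  obtain ⟨ρ, S, hρ, hlim, hnd⟩ := hL
  obtain ⟨Δ, -, hη, -, -, -⟩ := twoPoint_structure_of_limit hρ hlim hnd
  exact etaPositive_of_hasIsingExponentEta (etaPos_of_twoPointPowerLawEta h hρ hlim hnd hη) hη

/-- **Under stmt-4738, the crux 2600 ⟺ ¬(stmt-15521)** (`CanonicalBranchRefutation.InfraredExponentZero`,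
the branch hypothesis `η_log(3) = 0`). `→` is unconditional (`not_infraredExponentZero_of_etaPositive`,
sphere-mass bookkeeping); `←`: the given limit has `η = 2Δ - 1` with `Δ ∈ [1/2, 3/4]`; `Δ = 1/2` would be
`InfraredExponentZero`, so `Δ > 1/2` and `η > 0`. [folklore] -/
theorem EtaPositive_iff_not_infraredExponentZero_of_limitExists (hL : WeylWindow.LimitExists) :
    AnomalousForcesInteraction.EtaPositive ↔ ¬ CanonicalBranchRefutation.InfraredExponentZero := by
  refine ⟨not_infraredExponentZero_of_etaPositive, fun h0 => ?_⟩
  obtain ⟨ρ, S, hρ, hlim, hnd⟩ := hL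
  obtain ⟨Δ, hwin, hη, -, -, -⟩ := twoPoint_structure_of_limit hρ hlim hnd
  rcases eq_or_lt_of_le hwin.1 with heq | hlt
  · exfalso
    apply h0
    have e : 2 * Δ - 1 = 0 := by rw [← heq]; norm_num
    rw [e] at hη
    exact hη
  · exact etaPositive_of_hasIsingExponentEta (by linarith) hη

open Classical in
/-- **Under stmt-4738, the crux 2600 ⟺ every non-degenerate limit has scaling dimension `> 1/2`**
(the normalised family of any such limit is scale covariant with a unique `Δ`; composition of
`EtaPositive_iff_twoPointPowerLawEta_of_limitExists` with `twoPointPowerLawEta_iff_half_lt_delta`). [folklore] -/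
theorem EtaPositive_iff_half_lt_delta_of_limitExists (hL : WeylWindow.LimitExists) :
    AnomalousForcesInteraction.EtaPositive ↔
      ∀ (ρ : ℝ → ℝ) (S : CorrFamily 3) (Δ : ℝ), (∀ δ ∈ Set.Ioc (0:ℝ) 1, 0 < ρ δ) →
        HasPointwiseScalingLimit (criticalCorr 3) ρ S → IsNondegenerateTwoPoint S →
        IsScaleCovariant Δ (fun n x => if x ∈ NonCoincident 3 n then S n x else 0) → 1 / 2 < Δ :=
  (EtaPositive_iff_twoPointPowerLawEta_of_limitExists hL).trans twoPointPowerLawEta_iff_half_lt_delta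

/-- **Inside this route: under `MoebiusLimit` (stmt-1344), `EtaPositive` ⟺ `TwoPointPowerLawEta` (stmt-5354).**
[folklore] -/
theorem EtaPositive_iff_twoPointPowerLawEta_of_moebiusLimit (hM : AnomalousForcesInteraction.MoebiusLimit) :
    AnomalousForcesInteraction.EtaPositive ↔ PrimaryAtInfinity.TwoPointPowerLawEta :=
  EtaPositive_iff_twoPointPowerLawEta_of_limitExists (limitExists_of_moebiusLimit hM)

/-- **Inside this route: under `MoebiusLimit` (stmt-1344), `EtaPositive` ⟺ `¬ InfraredExponentZero`
(stmt-15521).** [folklore] -/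
theorem EtaPositive_iff_not_infraredExponentZero_of_moebiusLimit
    (hM : AnomalousForcesInteraction.MoebiusLimit) :
    AnomalousForcesInteraction.EtaPositive ↔ ¬ CanonicalBranchRefutation.InfraredExponentZero :=
  EtaPositive_iff_not_infraredExponentZero_of_limitExists (limitExists_of_moebiusLimit hM)

/-! ### The unconditional dichotomy -/

open Classical in
/-- **Either the crux holds, or every scaling limit of critical Ising₃ is canonical.** Unconditionally:
`EtaPositive`, or else EVERY non-degenerate pointwise scaling limit `(ρ, S)` of `criticalCorr 3` (`ρ > 0` on
`(0,1]`) has logarithmic exponent `η(3) = 0` (`HasIsingExponentEta 3 0`), vanishing connected four-point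
function on non-coincident quadruples (`¬ HasNontrivialU4 S`), and normalised scaling dimension exactly `1/2`.
Proof: `twoPoint_structure_of_limit` gives `Δ ∈ [1/2, 3/4]` with `η = 2Δ - 1`, covariance of the normalised
family and `U₄ ≢ 0 → 1/2 < Δ`; if `Δ > 1/2` the positive logarithmic `η` is the crux. So a refutation of the
crux lives on the canonical branch, and one interacting (or merely `Δ > 1/2`) limit proves it.
(Registered sub-goal of the crux item; header verbatim on one line.) [cite: DuminilCopinICM2022, §8.4] -/
theorem EtaPositive_or_canonical : Summit.CriticalPhenomena.Ising3DConformalLimit.Theses.AnomalousForcesInteraction.EtaPositive ∨ ∀ (ρ : ℝ → ℝ) (S : Literature.Probability.LatticeModels.CorrFamily 3), (∀ δ ∈ Set.Ioc (0:ℝ) 1, 0 < ρ δ) → Literature.Probability.LatticeModels.HasPointwiseScalingLimit (Literature.Probability.LatticeModels.criticalCorr 3) ρ S → Literature.Probability.LatticeModels.IsNondegenerateTwoPoint S → Literature.Probability.LatticeModels.HasIsingExponentEta 3 0 ∧ ¬ Literature.Probability.LatticeModels.HasNontrivialU4 S ∧ Literature.Probability.LatticeModels.IsScaleCovariant (1 /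 2) (fun n x => if x ∈ Literature.Probability.LatticeModels.NonCoincident 3 n then S n x else 0) := by
  by_cases h : AnomalousForcesInteraction.EtaPositive
  · exact Or.inl h
  · refine Or.inr fun ρ S hρ hlim hnd => ?_
    obtain ⟨Δ, hwin, hη, hsc, hgt, -⟩ := twoPoint_structure_of_limit hρ hlim hnd
    have hΔ : Δ = 1 / 2 := by
      by_contra hne
      have hlt : 1 / 2 < Δ := lt_of_le_of_ne hwin.1 (Ne.symm hne)
      exact h (etaPositive_of_hasIsingExponentEta (by linarith) hη)
    subst hΔ
    have e : (2 : ℝ) * (1 / 2) - 1 = 0 := by norm_num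
    rw [e] at hη
    exact ⟨hη, fun hU => lt_irrefl _ (hgt hU), hsc⟩

/-- **Corollary: if the crux fails and one non-degenerate limit exists, the canonical bet stmt-15521 holds**
(`InfraredExponentZero`), i.e. `η_log(3) = 0`. [folklore] -/
theorem infraredExponentZero_of_not_etaPositive_of_limitExists
    (h : ¬ AnomalousForcesInteraction.EtaPositive) (hL : WeylWindow.LimitExists) :
    CanonicalBranchRefutation.InfraredExponentZero := by
  by_contra h0
  exact h ((EtaPositive_iff_not_infraredExponentZero_of_limitExists hL).2 h0)

end Summit.CriticalPhenomena.Ising3DConformalLimit.AnomalousForcesInteractionEtaPositive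

end
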